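import Mathlib
import Summits.ValiantsHypothesis.ValiantsHypothesis.Theorems.NewtonTauWeak.Negative.Zonogon
import Summits.ValiantsHypothesis.ValiantsHypothesis.Theorems.NewtonUnitEquationsNewtonTauWeakSquareRegime
import Summits.ValiantsHypothesis.ValiantsHypothesis.Theorems.NewtonUnitEquationsNewtonTauWeakGradedDesignT2
import Summits.ValiantsHypothesis.ValiantsHypothesis.Theorems.NewtonUnitEquationsNewtonTauWeakShadowMinkowski
import Summits.ValiantsHypothesis.ValiantsHypothesis.Theorems.NewtonUnitEquationsNewtonTauWeakShadowAdditivity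

/-!
# `NewtonUnitEquationsNewtonTauWeakWeightedLevelSetQuasi` — THEOREM W-quasi: hull counts of weighted level sets are
# quasi-polynomial in the grade

Line `binomial-normal-form` of crux `NewtonTauWeak` (stmt-ValiantsHypothesis-5904), QUASI rung (registered stubs
`weightedLevelSetPhi_le`, `weightedLevelSetHull_quasi`, `weightedLevelSetHull_kernelQuasi`).

Setting.  Items `j : Fin N` with weights `1 ≤ g j ≤ c` and exponents `d j ∈ ℕ²` (coincidences allowed);
`X_v = {Σ_{j ∈ J} d j : Σ_{j ∈ J} g j = v} ⊆ ℕ²`.  For a finite `S ⊆ ℕ²` and `σ = ±1`, `U σ S` is the set of points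
of `S` that are the UNIQUE maximiser over `S` of `s ↦ t·x(s) + σ·y(s)` for some real slope `t` (`U` is a parameter
characterised by `hU`); `Φ S = |U 1 S| + |U (-1) S|`.

* (`weightedLevelSetPhi_le`)  `Φ X_v ≤ 2 (cN + 2)^k` whenever `N ≤ 2^k`.  HALVING: splitting the items into halves
  of sizes `n₁ ≤ n₂`, `X_v = ⋃_{v₁ ≤ v} X_{v₁}(half 1) + X_{v - v₁}(half 2)` (`QuasiAux.levelSet_split`), only the
  `≤ c n₁ + 1` levels `v₁ ≤ c n₁` contribute, `Φ` is subadditive under unions (`QuasiAux.U_biUnion_subset`) and under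
  Minkowski sums (`card_uniqueMax_add_le`), so `Φ(N) ≤ (c n₁ + 1)(Φ(n₁) + Φ(n₂)) ≤ (cN + 2) · max Φ(half)`.
* (`weightedLevelSetHull_quasi`)  Hence `#ext conv X_v ≤ 2 (cN + 2)^k + 2` (`ncard_extremePoints_le_card_uniqueMax`:
  every extreme point is an upper vertex, a lower vertex, the leftmost or the rightmost point).
* (`weightedLevelSetHull_kernelQuasi`)  With the kernel bootstrap `kernelBootstrap` (`V(N, c) ≤ (4N² + 5)·V(4c², c)`):
  `#ext conv X_v ≤ (4N² + 5) · (2 (4c³ + 2)^k + 2)` whenever `4c·c ≤ 2^k` — polynomial in `N`, QUASI-POLYNOMIAL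
  `c^{O(log c)}` in the grade (THEOREM W had `(2c + 1)^{2c}`).  In T2 language: graded designs satisfy the stub's
  inequality up to a factor `K^{O(log K)}`, unconditionally.

Folklore (planar convexity, counting); no named facts, no citations, no `def`s.
-/

-- Sub = Summit single-conjunct layout: the duplicated namespace component is mandated by the tree.
set_option linter.dupNamespace false

noncomputable section

open scoped BigOperators
open MvPolynomial
open Summit.ValiantsHypothesis.ValiantsHypothesis.Theorems.NewtonTauWeak.Negative (vert)

namespace Summit.ValiantsHypothesis.ValiantsHypothesis.Theorems.NewtonUnitEquationsNewtonTauWeak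

namespace QuasiAux

variable (U : ℝ → Finset (Fin 2 →₀ ℕ) → Finset (Fin 2 →₀ ℕ))
  (hU : ∀ (σ : ℝ) (S : Finset (Fin 2 →₀ ℕ)) (s : Fin 2 →₀ ℕ), s ∈ U σ S ↔ s ∈ S ∧
    ∃ t : ℝ, ∀ s' ∈ S, s' ≠ s →
      t * ((s' 0 : ℕ) : ℝ) + σ * ((s' 1 : ℕ) : ℝ) < t * ((s 0 : ℕ) : ℝ) + σ * ((s 1 : ℕ) : ℝ))
include hU

/-- Unique maximisers lie in the set. [folklore] -/
theorem U_subset (σ : ℝ) (S : Finset (Fin 2 →₀ ℕ)) : U σ S ⊆ S := fun _ hs => ((hU σ S _).1 hs).1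

/-- **Union subadditivity.**  A unique maximiser over a union is a unique maximiser over the piece containing it.
[folklore] -/
theorem U_biUnion_subset {ι : Type*} [DecidableEq ι] (σ : ℝ) (I : Finset ι)
    (F : ι → Finset (Fin 2 →₀ ℕ)) : U σ (I.biUnion F) ⊆ I.biUnion fun i => U σ (F i) := by
  intro s hs
  obtain ⟨hsmem, t, ht⟩ := (hU σ _ s).1 hs
  obtain ⟨i, hi, hsi⟩ := Finset.mem_biUnion.1 hsmem
  exact Finset.mem_biUnion.2 ⟨i, hi, (hU σ _ s).2 ⟨hsi, t, fun s' hs' hne =>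
    ht s' (Finset.mem_biUnion.2 ⟨i, hi, hs'⟩) hne⟩⟩

omit hU in
/-- **Splitting the items.**  For items indexed by `Fin (n₁ + n₂)`, the weight-`v` level set of subset sums is the
union over `v₁ ≤ v` of the Minkowski sums of the level sets of the two halves at levels `v₁` and `v - v₁`
(`Fin.castAdd` / `Fin.natAdd` halves; a subset splits into its two traces, and two traces glue to a subset).
[folklore] -/
theorem levelSet_split (n₁ n₂ v : ℕ) (g : Fin (n₁ + n₂) → ℕ) (d : Fin (n₁ + n₂) → (Fin 2 →₀ ℕ)) :
    ((Finset.univ.filter fun J : Finset (Fin (n₁ + n₂)) => ∑ j ∈ J, g j = v).image fun J => ∑ j ∈ J, d j) =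
      (Finset.range (v + 1)).biUnion fun v₁ =>
        ((((Finset.univ.filter fun J : Finset (Fin n₁) => ∑ j ∈ J, g (Fin.castAdd n₂ j) = v₁).image
            fun J => ∑ j ∈ J, d (Fin.castAdd n₂ j)) ×ˢ
          ((Finset.univ.filter fun J : Finset (Fin n₂) => ∑ j ∈ J, g (Fin.natAdd n₁ j) = v - v₁).image
            fun J => ∑ j ∈ J, d (Fin.natAdd n₁ j))).image fun p => p.1 + p.2) := by
  classical
  -- traces of a subset on the two halves, and the splitting of sums
  have hsplit : ∀ {M : Type} [AddCommMonoid M] (f : Fin (n₁ + n₂) → M) (J : Finset (Fin (n₁ + n₂))),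
      ∑ j ∈ J, f j = ∑ i ∈ Finset.univ.filter (fun i : Fin n₁ => Fin.castAdd n₂ i ∈ J), f (Fin.castAdd n₂ i) +
        ∑ i ∈ Finset.univ.filter (fun i : Fin n₂ => Fin.natAdd n₁ i ∈ J), f (Fin.natAdd n₁ i) := by
    intro M _ f J
    rw [Finset.sum_filter, Finset.sum_filter, ← Fin.sum_univ_add (f := fun j => if j ∈ J then f j else 0),
      ← Finset.sum_filter, Finset.filter_mem_eq_inter, Finset.univ_inter]
  ext p
  simp only [Finset.mem_image, Finset.mem_filter, Finset.mem_univ, true_and, Finset.mem_biUnion,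
    Finset.mem_range, Finset.mem_product]
  constructor
  · rintro ⟨J, hJ, rfl⟩
    refine ⟨∑ i ∈ Finset.univ.filter (fun i : Fin n₁ => Fin.castAdd n₂ i ∈ J), g (Fin.castAdd n₂ i), ?_,
      ⟨∑ i ∈ Finset.univ.filter (fun i : Fin n₁ => Fin.castAdd n₂ i ∈ J), d (Fin.castAdd n₂ i),
        ∑ i ∈ Finset.univ.filter (fun i : Fin n₂ => Fin.natAdd n₁ i ∈ J), d (Fin.natAdd n₁ i)⟩,
      ⟨⟨_, rfl, rfl⟩, ⟨_, ?_, rfl⟩⟩, (hsplit d J).symm⟩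
    · have h := hsplit g J
      omega
    · have h := hsplit g J
      omega
  · rintro ⟨v₁, hv₁, ⟨p₁, p₂⟩, ⟨⟨J₁, hJ₁, rfl⟩, ⟨J₂, hJ₂, rfl⟩⟩, rfl⟩
    -- glue the two traces
    refine ⟨J₁.image (Fin.castAdd n₂) ∪ J₂.image (Fin.natAdd n₁), ?_, ?_⟩
    all_goals
      have h1 : (Finset.univ.filter fun i : Fin n₁ =>
          Fin.castAdd n₂ i ∈ J₁.image (Fin.castAdd n₂) ∪ J₂.image (Fin.natAdd n₁)) = J₁ := by
        ext i
        simp only [Finset.mem_filter, Finset.mem_univ, true_and, Finset.mem_union, Finset.mem_image]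
        constructor
        · rintro (⟨i', hi', h⟩ | ⟨i', _, h⟩)
          · rwa [← Fin.castAdd_injective _ _ h]
          · exact absurd (congrArg Fin.val h) (by simp only [Fin.val_natAdd, Fin.val_castAdd]; omega)
        · exact fun hi => Or.inl ⟨i, hi, rfl⟩
      have h2 : (Finset.univ.filter fun i : Fin n₂ =>
          Fin.natAdd n₁ i ∈ J₁.image (Fin.castAdd n₂) ∪ J₂.image (Fin.natAdd n₁)) = J₂ := by
        ext i
        simp only [Finset.mem_filter, Finset.mem_univ, true_and, Finset.mem_union, Finset.mem_image]
        constructor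
        · rintro (⟨i', _, h⟩ | ⟨i', hi', h⟩)
          · exact absurd (congrArg Fin.val h) (by simp only [Fin.val_natAdd, Fin.val_castAdd]; omega)
          · rwa [← Fin.natAdd_injective _ _ h]
        · exact fun hi => Or.inr ⟨i, hi, rfl⟩
    · rw [hsplit g, h1, h2, hJ₁, hJ₂]
      omega
    · rw [hsplit d, h1, h2]

omit hU in
/-- Beyond the total weight of the first half its level sets are empty. [folklore] -/
theorem levelSet_eq_empty (n c v : ℕ) (g : Fin n → ℕ) (hg : ∀ j, g j ≤ c) (d : Fin n → (Fin 2 →₀ ℕ))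
    (hv : c * n < v) :
    ((Finset.univ.filter fun J : Finset (Fin n) => ∑ j ∈ J, g j = v).image fun J => ∑ j ∈ J, d j) = ∅ := by
  refine Finset.image_eq_empty.2 (Finset.filter_eq_empty_iff.2 fun J _ hJ => ?_)
  have h1 : ∑ j ∈ J, g j ≤ ∑ j, g j := Finset.sum_le_sum_of_subset (Finset.subset_univ J)
  have h2 : ∑ j, g j ≤ ∑ _j : Fin n, c := Finset.sum_le_sum fun j _ => hg j
  rw [Finset.sum_const, Finset.card_univ, Fintype.card_fin, smul_eq_mul] at h2
  have h3 : n * c = c * n := Nat.mul_comm n c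
  omega

/-- With at most one item (weights `≥ 1`) a level set has at most one point, so `Φ ≤ 2`. [folklore] -/
theorem phi_le_two (N c v : ℕ) (hN : N ≤ 1) (g : Fin N → ℕ) (hg : ∀ j, 1 ≤ g j ∧ g j ≤ c)
    (d : Fin N → (Fin 2 →₀ ℕ)) :
    (U 1 (((Finset.univ.filter fun J : Finset (Fin N) => ∑ j ∈ J, g j = v).image
        fun J => ∑ j ∈ J, d j))).card +
      (U (-1) (((Finset.univ.filter fun J : Finset (Fin N) => ∑ j ∈ J, g j = v).image
        fun J => ∑ j ∈ J, d j))).card ≤ 2 := by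
  classical
  have hcard : ((Finset.univ.filter fun J : Finset (Fin N) => ∑ j ∈ J, g j = v).image
      fun J => ∑ j ∈ J, d j).card ≤ 1 := by
    refine Finset.card_image_le.trans (Finset.card_le_one.2 fun J hJ J' hJ' => ?_)
    have hJv := (Finset.mem_filter.1 hJ).2
    have hJ'v := (Finset.mem_filter.1 hJ').2
    rcases N with _ | _ | N
    · rw [Finset.eq_empty_of_isEmpty J, Finset.eq_empty_of_isEmpty J']
    · rcases Finset.subset_singleton_iff.1 (show J ⊆ {0} from fun x _ => by
          rw [Finset.mem_singleton]; exact Fin.eq_zero x) with rfl | rfl <;>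
        rcases Finset.subset_singleton_iff.1 (show J' ⊆ {0} from fun x _ => by
          rw [Finset.mem_singleton]; exact Fin.eq_zero x) with rfl | rfl
      · rfl
      · rw [Finset.sum_empty] at hJv
        rw [Finset.sum_singleton] at hJ'v
        have := (hg 0).1
        omega
      · rw [Finset.sum_empty] at hJ'v
        rw [Finset.sum_singleton] at hJv
        have := (hg 0).1
        omega
      · rfl
    · omega
  have h1 := (Finset.card_le_card (U_subset U hU 1 _)).trans hcard
  have h2 := (Finset.card_le_card (U_subset U hU (-1) _)).trans hcard
  omega

end QuasiAux

/-- **Halving bound for `Φ = |U 1 ·| + |U (-1) ·|` on weighted level sets, registered stub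
`weightedLevelSetPhi_le`.**  For weights `1 ≤ g j ≤ c` on `N ≤ 2^k` items and any exponents, the level set
`X_v = {Σ_{j ∈ J} d j : Σ_{j ∈ J} g j = v}` has `Φ X_v ≤ 2 (cN + 2)^k`.  Induction on `k`: split the items into
halves `n₁ ≤ n₂ ≤ 2^(k-1)`; by `QuasiAux.levelSet_split`, union subadditivity (`QuasiAux.U_biUnion_subset`) and
Minkowski subadditivity (`card_uniqueMax_add_le`), and since the first half only has levels `≤ c n₁`
(`QuasiAux.levelSet_eq_empty`), `Φ X_v ≤ (c n₁ + 1) · (2 (c n₁ + 2)^(k-1) + 2 (c n₂ + 2)^(k-1)) ≤ 2 (cN + 2)^k`.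
[folklore] -/
theorem weightedLevelSetPhi_le
    (U : ℝ → Finset (Fin 2 →₀ ℕ) → Finset (Fin 2 →₀ ℕ))
    (hU : ∀ (σ : ℝ) (S : Finset (Fin 2 →₀ ℕ)) (s : Fin 2 →₀ ℕ), s ∈ U σ S ↔ s ∈ S ∧
      ∃ t : ℝ, ∀ s' ∈ S, s' ≠ s →
        t * ((s' 0 : ℕ) : ℝ) + σ * ((s' 1 : ℕ) : ℝ) < t * ((s 0 : ℕ) : ℝ) + σ * ((s 1 : ℕ) : ℝ))
    (k N c v : ℕ) (hN : N ≤ 2 ^ k) (g : Fin N → ℕ) (hg : ∀ j, 1 ≤ g j ∧ g j ≤ c)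
    (d : Fin N → (Fin 2 →₀ ℕ)) :
    (U 1 (((Finset.univ.filter fun J : Finset (Fin N) => ∑ j ∈ J, g j = v).image
        fun J => ∑ j ∈ J, d j))).card +
      (U (-1) (((Finset.univ.filter fun J : Finset (Fin N) => ∑ j ∈ J, g j = v).image
        fun J => ∑ j ∈ J, d j))).card ≤ 2 * (c * N + 2) ^ k := by
  classical
  induction k generalizing N v with
  | zero =>
    rw [pow_zero, mul_one]
    exact QuasiAux.phi_le_two U hU N c v (by simpa using hN) g hg d
  | succ k ih =>
    by_cases hNk : N ≤ 2 ^ k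
    · refine (ih N v hNk g hg d).trans (Nat.mul_le_mul_left 2 ?_)
      exact Nat.pow_le_pow_right (by omega) (Nat.le_succ k)
    -- split `N = n₁ + n₂` with `n₁ ≤ n₂ ≤ 2^k`
    obtain ⟨n₁, n₂, rfl, hn₁, hn₂, h12⟩ : ∃ n₁ n₂, N = n₁ + n₂ ∧ n₁ ≤ 2 ^ k ∧ n₂ ≤ 2 ^ k ∧ n₁ ≤ n₂ :=
      ⟨N / 2, N - N / 2, by omega, by rw [pow_succ] at hN; omega, by rw [pow_succ] at hN; omega, by omega⟩
    -- the two half instances and their level sets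
    set g₁ : Fin n₁ → ℕ := fun i => g (Fin.castAdd n₂ i) with hg₁
    set g₂ : Fin n₂ → ℕ := fun i => g (Fin.natAdd n₁ i) with hg₂
    set d₁ : Fin n₁ → (Fin 2 →₀ ℕ) := fun i => d (Fin.castAdd n₂ i) with hd₁
    set d₂ : Fin n₂ → (Fin 2 →₀ ℕ) := fun i => d (Fin.natAdd n₁ i) with hd₂
    set A : ℕ → Finset (Fin 2 →₀ ℕ) := fun v₁ =>
      ((Finset.univ.filter fun J : Finset (Fin n₁) => ∑ j ∈ J, g₁ j = v₁).image fun J => ∑ j ∈ J, d₁ j) with hA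
    set B : ℕ → Finset (Fin 2 →₀ ℕ) := fun v₂ =>
      ((Finset.univ.filter fun J : Finset (Fin n₂) => ∑ j ∈ J, g₂ j = v₂).image fun J => ∑ j ∈ J, d₂ j) with hB
    have hsplit := QuasiAux.levelSet_split n₁ n₂ v g d
    -- per sign: union and Minkowski subadditivity, empty pieces beyond level `c n₁`
    have hσ : ∀ σ : ℝ, (U σ (((Finset.univ.filter fun J : Finset (Fin (n₁ + n₂)) => ∑ j ∈ J, g j = v).image
        fun J => ∑ j ∈ J, d j))).card ≤
        ∑ v₁ ∈ (Finset.range (v + 1)).filter (fun v₁ => v₁ ≤ c * n₁),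
          ((U σ (A v₁)).card + (U σ (B (v - v₁))).card) := by
      intro σ
      rw [hsplit]
      refine (Finset.card_le_card (QuasiAux.U_biUnion_subset U hU σ _ _)).trans
        (Finset.card_biUnion_le.trans ?_)
      rw [← Finset.sum_filter_add_sum_filter_not (Finset.range (v + 1)) (fun v₁ => v₁ ≤ c * n₁)]
      have hzero : ∑ v₁ ∈ (Finset.range (v + 1)).filter (fun v₁ => ¬ v₁ ≤ c * n₁),
          (U σ (((A v₁) ×ˢ (B (v - v₁))).image fun p => p.1 + p.2)).card = 0 := by
        refine Finset.sum_eq_zero fun v₁ hv₁ => ?_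
        have hlt : c * n₁ < v₁ := not_le.1 (Finset.mem_filter.1 hv₁).2
        have hAe : A v₁ = ∅ := QuasiAux.levelSet_eq_empty n₁ c v₁ g₁ (fun i => (hg _).2) d₁ hlt
        rw [Finset.card_eq_zero, ← Finset.subset_empty]
        refine (QuasiAux.U_subset U hU σ _).trans ?_
        rw [hAe, Finset.empty_product, Finset.image_empty]
      rw [hzero, add_zero]
      exact Finset.sum_le_sum fun v₁ _ => card_uniqueMax_add_le U hU σ (A v₁) (B (v - v₁))
    -- the induction hypothesis on the halves
    have hA' : ∀ v₁, (U 1 (A v₁)).card + (U (-1) (A v₁)).card ≤ 2 * (c * n₁ + 2) ^ k :=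
      fun v₁ => ih n₁ v₁ hn₁ g₁ (fun i => hg _) d₁
    have hB' : ∀ v₂, (U 1 (B v₂)).card + (U (-1) (B v₂)).card ≤ 2 * (c * n₂ + 2) ^ k :=
      fun v₂ => ih n₂ v₂ hn₂ g₂ (fun i => hg _) d₂
    have hF : ((Finset.range (v + 1)).filter fun v₁ => v₁ ≤ c * n₁).card ≤ c * n₁ + 1 := by
      calc _ ≤ (Finset.range (c * n₁ + 1)).card := Finset.card_le_card fun v₁ hv₁ =>
            Finset.mem_range.2 (Nat.lt_succ_of_le (Finset.mem_filter.1 hv₁).2)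
        _ = c * n₁ + 1 := Finset.card_range _
    have hpow₁ : (c * n₁ + 2) ^ k ≤ (c * (n₁ + n₂) + 2) ^ k :=
      Nat.pow_le_pow_left (by nlinarith [Nat.zero_le (c * n₂)]) k
    have hpow₂ : (c * n₂ + 2) ^ k ≤ (c * (n₁ + n₂) + 2) ^ k :=
      Nat.pow_le_pow_left (by nlinarith [Nat.zero_le (c * n₁)]) k
    calc _ ≤ ∑ v₁ ∈ (Finset.range (v + 1)).filter (fun v₁ => v₁ ≤ c * n₁),
          (((U 1 (A v₁)).card + (U (-1) (A v₁)).card) + ((U 1 (B (v - v₁))).card + (U (-1) (B (v - v₁))).card)) := by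
          refine (Nat.add_le_add (hσ 1) (hσ (-1))).trans (le_of_eq ?_)
          rw [← Finset.sum_add_distrib]
          exact Finset.sum_congr rfl fun v₁ _ => by ring
      _ ≤ ∑ _v₁ ∈ (Finset.range (v + 1)).filter (fun v₁ => v₁ ≤ c * n₁),
          (2 * (c * n₁ + 2) ^ k + 2 * (c * n₂ + 2) ^ k) :=
          Finset.sum_le_sum fun v₁ _ => Nat.add_le_add (hA' v₁) (hB' (v - v₁))
      _ = ((Finset.range (v + 1)).filter fun v₁ => v₁ ≤ c * n₁).card *
          (2 * (c * n₁ + 2) ^ k + 2 * (c * n₂ + 2) ^ k) := by rw [Finset.sum_const, smul_eq_mul]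
      _ ≤ (c * n₁ + 1) * (2 * (c * (n₁ + n₂) + 2) ^ k + 2 * (c * (n₁ + n₂) + 2) ^ k) :=
          Nat.mul_le_mul hF (by omega)
      _ ≤ 2 * (c * (n₁ + n₂) + 2) ^ (k + 1) := by
          rw [pow_succ]
          nlinarith [Nat.zero_le ((c * (n₁ + n₂) + 2) ^ k), Nat.mul_le_mul_left c h12]

/-- **THEOREM W-quasi (hull vertices of weighted level sets, quasi-polynomial bookkeeping form), registered stub
`weightedLevelSetHull_quasi`.**  For weights `1 ≤ g j ≤ c` on `N ≤ 2^k` items and any exponents `d j ∈ ℕ²`, the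
convex hull of `X_v = {Σ_{j ∈ J} d j : Σ_{j ∈ J} g j = v}` has at most `2 (cN + 2)^k + 2` extreme points: every
extreme point is an upper vertex, a lower vertex, the leftmost or the rightmost point
(`ncard_extremePoints_le_card_uniqueMax`), and `weightedLevelSetPhi_le`. [folklore] -/
theorem weightedLevelSetHull_quasi (k N c v : ℕ) (hN : N ≤ 2 ^ k) (g : Fin N → ℕ)
    (hg : ∀ j, 1 ≤ g j ∧ g j ≤ c) (d : Fin N → (Fin 2 →₀ ℕ)) :
    (Set.extremePoints ℝ (convexHull ℝ ((fun e : Fin 2 →₀ ℕ => fun i : Fin 2 => ((e i : ℕ) : ℝ)) ''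
      (((Finset.univ.filter fun J : Finset (Fin N) => ∑ j ∈ J, g j = v).image
        fun J => ∑ j ∈ J, d j : Finset (Fin 2 →₀ ℕ)) : Set (Fin 2 →₀ ℕ))))).ncard ≤
      2 * (c * N + 2) ^ k + 2 := by
  classical
  obtain ⟨U, hU⟩ : ∃ U : ℝ → Finset (Fin 2 →₀ ℕ) → Finset (Fin 2 →₀ ℕ),
      ∀ (σ : ℝ) (S : Finset (Fin 2 →₀ ℕ)) (s : Fin 2 →₀ ℕ), s ∈ U σ S ↔ s ∈ S ∧
        ∃ t : ℝ, ∀ s' ∈ S, s' ≠ s →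
          t * ((s' 0 : ℕ) : ℝ) + σ * ((s' 1 : ℕ) : ℝ) < t * ((s 0 : ℕ) : ℝ) + σ * ((s 1 : ℕ) : ℝ) :=
    ⟨fun σ S => S.filter fun s => ∃ t : ℝ, ∀ s' ∈ S, s' ≠ s →
        t * ((s' 0 : ℕ) : ℝ) + σ * ((s' 1 : ℕ) : ℝ) < t * ((s 0 : ℕ) : ℝ) + σ * ((s 1 : ℕ) : ℝ),
      fun σ S s => by simp only [Finset.mem_filter]⟩
  exact (ncard_extremePoints_le_card_uniqueMax U hU _).trans
    (Nat.add_le_add_right (weightedLevelSetPhi_le U hU k N c v hN g hg d) 2)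

/-- **Kernel form: polynomial in `N`, quasi-polynomial in the grade, registered stub
`weightedLevelSetHull_kernelQuasi`.**  For weights `1 ≤ g j ≤ c` and any exponents, whenever `4c·c ≤ 2^k` the convex
hull of `X_v` has at most `(4N² + 5) · (2 (4c³ + 2)^k + 2)` extreme points: the kernel bootstrap `kernelBootstrap`
(`V(N, c) ≤ (4N² + 5) · V(4c², c)`) fed with `weightedLevelSetHull_quasi` on kernels of `n ≤ 4c·c ≤ 2^k` items
(`c n ≤ 4c³`).  With `k = ⌈log₂ (4c²)⌉` this is `poly(N) · c^{O(log c)}`. [folklore] -/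
theorem weightedLevelSetHull_kernelQuasi (k N c v : ℕ) (hk : 4 * c * c ≤ 2 ^ k) (g : Fin N → ℕ)
    (hg : ∀ j, 1 ≤ g j ∧ g j ≤ c) (d : Fin N → (Fin 2 →₀ ℕ)) :
    (Set.extremePoints ℝ (convexHull ℝ ((fun e : Fin 2 →₀ ℕ => fun i : Fin 2 => ((e i : ℕ) : ℝ)) ''
      (((Finset.univ.filter fun J : Finset (Fin N) => ∑ j ∈ J, g j = v).image
        fun J => ∑ j ∈ J, d j : Finset (Fin 2 →₀ ℕ)) : Set (Fin 2 →₀ ℕ))))).ncard ≤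
      (4 * (N * N) + 5) * (2 * (4 * c * c * c + 2) ^ k + 2) := by
  refine kernelBootstrap N c v _ g hg d fun n v' g' d' hn hg' => ?_
  refine (weightedLevelSetHull_quasi k n c v' (hn.trans hk) g' hg' d').trans ?_
  have h : c * n + 2 ≤ 4 * c * c * c + 2 := by nlinarith [Nat.mul_le_mul_left c hn]
  exact Nat.add_le_add_right (Nat.mul_le_mul_left 2 (Nat.pow_le_pow_left h k)) 2

/-- **T2 on GRADED DESIGNS up to a quasi-polynomial factor in the grade, uniformly in the number of products,
registered stub `gradedDesignT2_quasi`.**  On a dissociated exponent list `d` with nonzero `ρ j` and grades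
`1 ≤ g j ≤ c`, `4c·c ≤ 2^k`, the design `Σ_{l<K} cf_l Π_j (1 − u_l^{g j} ρ_j X^{d j})` (any `K`, `u`, `cf`) has at most
`(Σ_j g j + 1) · (4N² + 5) · (2 (4c³ + 2)^k + 2)` Newton vertices: its support is a union of at most `Σ g + 1` weighted
level sets (`stub_gradedDesignT2OfHull`), each bounded by `weightedLevelSetHull_kernelQuasi`. [folklore] -/
theorem gradedDesignT2_quasi (k N c K : ℕ) (hk : 4 * c * c ≤ 2 ^ k) (g : Fin N → ℕ)
    (hg : ∀ j, 1 ≤ g j ∧ g j ≤ c) (u cf : Fin K → ℂ) (ρ : Fin N → ℂ) (hρ : ∀ j, ρ j ≠ 0)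
    (d : Fin N → (Fin 2 →₀ ℕ)) (hdis : ∀ J J' : Finset (Fin N), ∑ j ∈ J, d j = ∑ j ∈ J', d j → J = J') :
    vert (∑ l, C (cf l) * ∏ j, (1 - C (u l ^ g j * ρ j) * monomial (d j) 1)) ≤
      (∑ j, g j + 1) * ((4 * (N * N) + 5) * (2 * (4 * c * c * c + 2) ^ k + 2)) :=
  stub_gradedDesignT2OfHull N K _ g u cf ρ hρ d hdis fun v => weightedLevelSetHull_kernelQuasi k N c v hk g hg d

end Summit.ValiantsHypothesis.ValiantsHypothesis.Theorems.NewtonUnitEquationsNewtonTauWeak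

end
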